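import Literature.NumberTheory.Transcendental.BoxIntegralHurwitzWeightTwo
import Literature.NumberTheory.Transcendental.AperyIrrationality
import HarnessLib

/-!
# Hurwitz box integrals in weight `n`: `∫_{(0,1)ⁿ} (x₀⋯x_{n−1})ʳ dx/(1 − (x₀⋯x_{n−1})ᵐ) = Σ_k (mk+r+1)⁻ⁿ`,
and the weight-`3`, level-`2` sector: `h₀ = 7ζ(3)/8`, `h₁ = ζ(3)/8`, normal forms `a + bζ(3)`

Sequel of `BoxIntegralZetaValues.lean` (`∫_{(0,1)ⁿ} dx/(1 − ∏xᵢ) = ζ(n)`) and of the weight-`2`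
file `BoxIntegralHurwitzWeightTwo.lean`, in the literal shape
`∫ x in {x : Fin n → ℝ | ∀ i, x i ∈ Ioo 0 1}, …` of the tree's Kontsevich–Zagier calculus. The
weight-`n`, level-`m` "box sector" consists of the integrands `P(∏xᵢ)/(1 − (∏xᵢ)ᵐ)`, whose
values are spanned by `∫_{(0,1)ⁿ} (∏xᵢ)ʳ/(1 − (∏xᵢ)ᵐ) = Σ_{k≥0} (mk+r+1)⁻ⁿ = m⁻ⁿ ζ(n, (r+1)/m)`.
Route HurwitzMicroSectors of summit KontsevichZagierPeriods calibrates its method on the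
UNCONDITIONAL weight-`3`, level-`2` rung (item AperySectorThreeTwo: "values lie in `ℚ + ℚζ(3)`
(`h₀ = Σ1/(2j+1)³ = 7ζ(3)/8`, `h₁ = ζ(3)/8`), normal forms `a + b/(1−xyz)`; reduction = ONE
dilation (`H₀ + H₁ ∼ 8H₁`) …; rigidity = `ζ(3) ∉ ℚ`, which is PROVED in tree").

This file PROVES:

* `BoxIntegral.integrableOn_box_prod_pow_div_one_sub_prod_pow`,
  `BoxIntegral.setIntegral_box_prod_pow_div_one_sub_prod_pow` — for `n ≥ 2`, `m ≥ 1`, `r ≥ 0`: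
  `(∏xᵢ)ʳ/(1 − (∏xᵢ)ᵐ)` is integrable on the open box (dominated by `1/(1 − ∏xᵢ)`) and
  **`∫_{(0,1)ⁿ} (∏xᵢ)ʳ dx/(1 − (∏xᵢ)ᵐ) = Σ_{k≥0} 1/(mk+r+1)ⁿ`**;
* weight `3`, level `2`: `tsum_one_div_two_mul_add_one_cube` (`Σ 1/(2k+1)³ = 7ζ(3)/8`),
  `tsum_one_div_two_mul_add_two_cube` (`Σ 1/(2k+2)³ = ζ(3)/8`), the box integrals
  `box_integral_level_two_weight_three_zero` (`h₀ = 7ζ(3)/8`), `…_one` (`h₁ = ζ(3)/8`) with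
  integrability, the relation `level_two_weight_three_relation` (`h₀ + h₁ = 8h₁`), the
  normal-form integral `box_integral_normalForm_weight_three`
  (`∫_{(0,1)³}(a + b/(1 − x₀x₁x₂)) = a + b·zetaValue 3`) and the UNCONDITIONAL rigidity
  `normalForm_weight_three_coeff_eq` (from the tree's `Apery.irrational_zeta_three`).

`ζ(3) = zetaValue 3` (`PeriodsWave0.lean`). No named facts (D-0026); everything is unconditional.

## References

* [Beukers1979] F. Beukers, *A note on the irrationality of `ζ(2)` and `ζ(3)`*, Bull. London Math.
  Soc. 11 (1979) 268–272.
* [KontsevichZagier2001] M. Kontsevich, D. Zagier, *Periods* (2001), §1.1.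
* [Apery1979] R. Apéry, *Irrationalité de `ζ(2)` et `ζ(3)`*, Astérisque 61 (1979) 11–13
  (`ζ(3) ∉ ℚ`, used through `AperyIrrationality.lean`).
-/

noncomputable section

open MeasureTheory Set Filter Real Finset

namespace Literature.NumberTheory.Transcendental

namespace BoxIntegral

variable {n : ℕ}

/-! The kernel facts `uʳ/(1 − uᵐ) ≤ 1/(1−u)` and `uʳ/(1 − uᵐ) = Σ_k u^{mk+r}` (`0 ≤ u < 1`,
`m ≥ 1`) are `BoxIntegral.pow_div_one_sub_pow_le` and `BoxIntegral.hasSum_pow_mul_add` of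
`BoxIntegralHurwitzWeightTwo.lean`; the volume of the box and the constant integrals are
`BoxIntegral.volume_box`, `BoxIntegral.setIntegral_box_const`, `BoxIntegral.integrableOn_box_const`
there. -/

/-- `Σ_k 1/(mk+r+1)ⁿ` converges for `n ≥ 2`, `m ≥ 1` (compare with `Σ 1/(k+1)ⁿ`). [folklore] -/
theorem summable_one_div_mul_add_pow (hn : 2 ≤ n) {m : ℕ} (hm : 1 ≤ m) (r : ℕ) :
    Summable fun k : ℕ => 1 / ((m : ℝ) * k + r + 1) ^ n := by
  have h := summable_one_div_succ_pow' hn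
  refine h.of_nonneg_of_le (fun k => by positivity) fun k => ?_
  rw [one_div_pow]
  have hm' : (1 : ℝ) ≤ m := by exact_mod_cast hm
  have hk : (0 : ℝ) ≤ k := k.cast_nonneg
  have hr : (0 : ℝ) ≤ r := r.cast_nonneg
  have hle : (k : ℝ) + 1 ≤ (m : ℝ) * k + r + 1 := by nlinarith [mul_le_mul_of_nonneg_right hm' hk]
  exact one_div_le_one_div_of_le (by positivity) (pow_le_pow_left₀ (by positivity) hle n)

/-! ### The Hurwitz box integral in weight `n` -/

/-- **`(x₀⋯x_{n−1})ʳ/(1 − (x₀⋯x_{n−1})ᵐ)` is integrable on the open unit box** for `n ≥ 2`,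
`m ≥ 1` (dominated by `1/(1 − x₀⋯x_{n−1})`, `integrableOn_box_one_div_one_sub_prod`). [folklore] -/
theorem integrableOn_box_prod_pow_div_one_sub_prod_pow (hn : 2 ≤ n) {m : ℕ} (hm : 1 ≤ m) (r : ℕ) :
    IntegrableOn (fun x : Fin n → ℝ => (∏ i, x i) ^ r / (1 - (∏ i, x i) ^ m))
      {x | ∀ i, x i ∈ Ioo (0 : ℝ) 1} volume := by
  have hn0 : n ≠ 0 := by omega
  refine Integrable.mono' (integrableOn_box_one_div_one_sub_prod hn)
    ((by fun_prop : Measurable fun x : Fin n → ℝ =>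
      (∏ i, x i) ^ r / (1 - (∏ i, x i) ^ m)).aestronglyMeasurable) ?_
  refine ae_restrict_of_forall_mem (Beukers.measurableSet_cube n) fun x hx => ?_
  have hu := prod_mem_Ioo hn0 hx
  have hden : 0 < 1 - (∏ i, x i) ^ m := by
    have : (∏ i, x i) ^ m < 1 := pow_lt_one₀ hu.1.le hu.2 (by omega)
    linarith
  rw [Real.norm_eq_abs, abs_of_nonneg (div_nonneg (pow_nonneg hu.1.le r) hden.le)]
  exact pow_div_one_sub_pow_le hu.1.le hu.2 hm r

/-- **The Hurwitz box integral in weight `n`**: for `n ≥ 2`, `m ≥ 1`, `r ≥ 0`,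
`∫_{(0,1)ⁿ} (x₀⋯x_{n−1})ʳ dx/(1 − (x₀⋯x_{n−1})ᵐ) = Σ_{k≥0} 1/(mk+r+1)ⁿ` (`= m⁻ⁿ ζ(n, (r+1)/m)`):
expand `uʳ/(1−uᵐ) = Σ u^{mk+r}` and integrate term-wise (`∫ (x₀⋯x_{n−1})ʲ = (j+1)⁻ⁿ`).
[folklore] -/
theorem setIntegral_box_prod_pow_div_one_sub_prod_pow (hn : 2 ≤ n) {m : ℕ} (hm : 1 ≤ m) (r : ℕ) :
    ∫ x in {x : Fin n → ℝ | ∀ i, x i ∈ Ioo (0 : ℝ) 1}, (∏ i, x i) ^ r / (1 - (∏ i, x i) ^ m)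
      = ∑' k : ℕ, 1 / ((m : ℝ) * k + r + 1) ^ n := by
  have hn0 : n ≠ 0 := by omega
  have hval : ∀ k : ℕ, ∫ x in {x : Fin n → ℝ | ∀ i, x i ∈ Ioo (0 : ℝ) 1}, (∏ i, x i) ^ (m * k + r)
      = 1 / ((m : ℝ) * k + r + 1) ^ n := by
    intro k
    rw [setIntegral_box_prod_pow, one_div_pow]
    push_cast
    ring_nf
  have hnorm : ∀ k : ℕ, ∫ x in {x : Fin n → ℝ | ∀ i, x i ∈ Ioo (0 : ℝ) 1}, ‖(∏ i, x i) ^ (m * k + r)‖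
      = 1 / ((m : ℝ) * k + r + 1) ^ n := by
    intro k
    rw [← hval k]
    exact setIntegral_congr_fun (Beukers.measurableSet_cube n) fun x hx =>
      Real.norm_of_nonneg (pow_nonneg (prod_mem_Ioo hn0 hx).1.le _)
  have hsum : Summable fun k : ℕ =>
      ∫ x in {x : Fin n → ℝ | ∀ i, x i ∈ Ioo (0 : ℝ) 1}, ‖(∏ i, x i) ^ (m * k + r)‖ := by
    simp_rw [hnorm]
    exact summable_one_div_mul_add_pow hn hm r
  have h := hasSum_integral_of_summable_integral_norm
    (μ := volume.restrict {x : Fin n → ℝ | ∀ i, x i ∈ Ioo (0 : ℝ) 1})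
    (F := fun (k : ℕ) (x : Fin n → ℝ) => (∏ i, x i) ^ (m * k + r))
    (fun k => integrableOn_box_prod_pow n _) hsum
  simp only [hval] at h
  rw [h.tsum_eq]
  refine setIntegral_congr_fun (Beukers.measurableSet_cube n) fun x hx => ?_
  have hu := prod_mem_Ioo hn0 hx
  exact ((hasSum_pow_mul_add hu.1.le hu.2 hm r).tsum_eq).symm

/-! ### Weight `3`, level `2`: `h_r = ∫_{(0,1)³} (x₀x₁x₂)ʳ dx/(1 − (x₀x₁x₂)²)` and `ζ(3)` -/

/-- The even/odd split of `ζ(3)`: `Σ_k 1/(2k+1)³ + Σ_k 1/(2k+2)³ = ζ(3)` with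
`Σ_k 1/(2k+2)³ = ζ(3)/8`, hence `Σ_k 1/(2k+1)³ = 7ζ(3)/8`. [folklore] -/
theorem tsum_one_div_two_mul_add_one_cube :
    ∑' k : ℕ, 1 / ((2 : ℝ) * k + 1) ^ 3 = 7 / 8 * zetaValue 3 := by
  -- `Σ 1/(j+1)³ = ζ(3)`
  have htot : HasSum (fun j : ℕ => 1 / ((j : ℝ) + 1) ^ 3) (zetaValue 3) := by
    have h := (summable_one_div_succ_pow' (n := 3) (by norm_num)).hasSum
    simp_rw [one_div_pow] at h
    rwa [tsum_one_div_succ_pow_eq_zetaValue' (n := 3) (by norm_num)] at h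
  -- even part: `k ↦ 1/(2k+1)³`, odd part: `k ↦ 1/(2k+2)³ = (1/8)·1/(k+1)³`
  have hs : Summable (fun k : ℕ => 1 / ((2 : ℝ) * k + 1) ^ 3) := by
    refine (summable_one_div_mul_add_pow (n := 3) (by norm_num) (m := 2) (by norm_num) 0).congr
      fun k => ?_
    push_cast
    ring_nf
  have heven : HasSum (fun k : ℕ => 1 / (((2 * k : ℕ) : ℝ) + 1) ^ 3)
      (∑' k : ℕ, 1 / ((2 : ℝ) * k + 1) ^ 3) := by
    refine hs.hasSum.congr_fun fun k => ?_
    push_cast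
    ring_nf
  have hodd : HasSum (fun k : ℕ => 1 / (((2 * k + 1 : ℕ) : ℝ) + 1) ^ 3) (1 / 8 * zetaValue 3) := by
    have h := htot.mul_left (1 / 8)
    refine h.congr_fun fun k => ?_
    push_cast
    have : ((2 : ℝ) * k + 1 + 1) ^ 3 = 8 * ((k : ℝ) + 1) ^ 3 := by ring
    rw [this, ← one_div_mul_one_div]
  have hsplit := (HasSum.even_add_odd (f := fun j : ℕ => 1 / ((j : ℝ) + 1) ^ 3) heven hodd).unique htot
  linarith

/-- `Σ_k 1/(2k+2)³ = ζ(3)/8`. [folklore] -/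
theorem tsum_one_div_two_mul_add_two_cube :
    ∑' k : ℕ, 1 / ((2 : ℝ) * k + 2) ^ 3 = 1 / 8 * zetaValue 3 := by
  rw [← tsum_one_div_succ_pow_eq_zetaValue' (n := 3) (by norm_num), ← tsum_mul_left]
  refine tsum_congr fun k => ?_
  have : ((2 : ℝ) * k + 2) ^ 3 = 8 * ((k : ℝ) + 1) ^ 3 := by ring
  rw [this, ← one_div_mul_one_div]

/-- **`h₀ = ∫_{(0,1)³} dx/(1 − (x₀x₁x₂)²) = Σ 1/(2k+1)³ = 7ζ(3)/8`**, with the integrability.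
[folklore] -/
theorem box_integral_level_two_weight_three_zero :
    IntegrableOn (fun x : Fin 3 → ℝ => (x 0 * x 1 * x 2) ^ 0 / (1 - (x 0 * x 1 * x 2) ^ 2))
        {x | ∀ i, x i ∈ Ioo (0 : ℝ) 1} volume ∧
      ∫ x in {x : Fin 3 → ℝ | ∀ i, x i ∈ Ioo (0 : ℝ) 1}, (x 0 * x 1 * x 2) ^ 0 / (1 - (x 0 * x 1 * x 2) ^ 2)
        = 7 / 8 * zetaValue 3 := by
  have h1 := integrableOn_box_prod_pow_div_one_sub_prod_pow (n := 3) (by norm_num) (m := 2)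
    (by norm_num) 0
  have h2 := setIntegral_box_prod_pow_div_one_sub_prod_pow (n := 3) (by norm_num) (m := 2)
    (by norm_num) 0
  simp only [Fin.prod_univ_three] at h1 h2
  refine ⟨h1, ?_⟩
  rw [h2, ← tsum_one_div_two_mul_add_one_cube]
  refine tsum_congr fun k => ?_
  push_cast
  ring_nf

/-- **`h₁ = ∫_{(0,1)³} x₀x₁x₂ dx/(1 − (x₀x₁x₂)²) = Σ 1/(2k+2)³ = ζ(3)/8`**, with the integrability.
[folklore] -/
theorem box_integral_level_two_weight_three_one :
    IntegrableOn (fun x : Fin 3 → ℝ => (x 0 * x 1 * x 2) ^ 1 / (1 - (x 0 * x 1 * x 2) ^ 2))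
        {x | ∀ i, x i ∈ Ioo (0 : ℝ) 1} volume ∧
      ∫ x in {x : Fin 3 → ℝ | ∀ i, x i ∈ Ioo (0 : ℝ) 1}, (x 0 * x 1 * x 2) ^ 1 / (1 - (x 0 * x 1 * x 2) ^ 2)
        = 1 / 8 * zetaValue 3 := by
  have h1 := integrableOn_box_prod_pow_div_one_sub_prod_pow (n := 3) (by norm_num) (m := 2)
    (by norm_num) 1
  have h2 := setIntegral_box_prod_pow_div_one_sub_prod_pow (n := 3) (by norm_num) (m := 2)
    (by norm_num) 1
  simp only [Fin.prod_univ_three] at h1 h2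
  refine ⟨h1, ?_⟩
  rw [h2, ← tsum_one_div_two_mul_add_two_cube]
  refine tsum_congr fun k => ?_
  push_cast
  ring_nf

/-- **The level-`2` distribution relation in weight `3`**: `h₀ + h₁ = 8h₁` (i.e. `h₀ = 7h₁`;
route HurwitzMicroSectors: "`H₀ + H₁ ∼ 8H₁`", the `m = 2` dilation). [folklore] -/
theorem level_two_weight_three_relation :
    (∫ x in {x : Fin 3 → ℝ | ∀ i, x i ∈ Ioo (0 : ℝ) 1}, (x 0 * x 1 * x 2) ^ 0 / (1 - (x 0 * x 1 * x 2) ^ 2))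
      + (∫ x in {x : Fin 3 → ℝ | ∀ i, x i ∈ Ioo (0 : ℝ) 1}, (x 0 * x 1 * x 2) ^ 1 / (1 - (x 0 * x 1 * x 2) ^ 2))
      = 8 * ∫ x in {x : Fin 3 → ℝ | ∀ i, x i ∈ Ioo (0 : ℝ) 1},
          (x 0 * x 1 * x 2) ^ 1 / (1 - (x 0 * x 1 * x 2) ^ 2) := by
  rw [box_integral_level_two_weight_three_zero.2, box_integral_level_two_weight_three_one.2]
  ring

/-! ### The weight-`3` normal form `a + b/(1 − x₀x₁x₂)` -/

/-- **The weight-`3` normal-form integral**: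
`∫_{(0,1)³} (a + b/(1 − x₀x₁x₂)) dx = a + b·ζ(3)`, with the integrability
(`box_integral_one_div_one_sub_mul_three`; the box has volume `1`). [folklore] -/
theorem box_integral_normalForm_weight_three (a b : ℝ) :
    IntegrableOn (fun x : Fin 3 → ℝ => a + b / (1 - x 0 * x 1 * x 2)) {x | ∀ i, x i ∈ Ioo (0 : ℝ) 1} volume ∧
      ∫ x in {x : Fin 3 → ℝ | ∀ i, x i ∈ Ioo (0 : ℝ) 1}, (a + b / (1 - x 0 * x 1 * x 2))
        = a + b * zetaValue 3 := by
  have hz := box_integral_one_div_one_sub_mul_three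
  have ha : IntegrableOn (fun _ : Fin 3 → ℝ => a) {x | ∀ i, x i ∈ Ioo (0 : ℝ) 1} volume :=
    integrableOn_box_const 3 a
  have hb : IntegrableOn (fun x : Fin 3 → ℝ => b / (1 - x 0 * x 1 * x 2)) {x | ∀ i, x i ∈ Ioo (0 : ℝ) 1} volume := by
    have hb' : IntegrableOn (fun x : Fin 3 → ℝ => b * (1 / (1 - x 0 * x 1 * x 2)))
        {x | ∀ i, x i ∈ Ioo (0 : ℝ) 1} volume := hz.1.const_mul b
    refine IntegrableOn.congr_fun hb' (fun x _ => ?_) (Beukers.measurableSet_cube 3)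
    simp only [mul_one_div]
  refine ⟨ha.add hb, ?_⟩
  rw [integral_add ha hb, setIntegral_box_const]
  congr 1
  rw [← hz.2, ← integral_const_mul]
  refine setIntegral_congr_fun (Beukers.measurableSet_cube 3) fun x _ => ?_
  rw [mul_one_div]

/-- **Rigidity of the weight-`3` normal form, UNCONDITIONALLY** (Apéry: `ζ(3) ∉ ℚ`, the tree's
`Apery.irrational_zeta_three`): two rational normal forms `a + bζ(3)`, `a' + b'ζ(3)` with equal
values have equal coefficients. [folklore] -/
theorem normalForm_weight_three_coeff_eq {a b a' b' : ℚ}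
    (heq : (a : ℝ) + b * zetaValue 3 = a' + b' * zetaValue 3) : a = a' ∧ b = b' := by
  have hirr := Apery.irrational_zeta_three
  by_cases hb : b = b'
  · subst hb
    refine ⟨?_, rfl⟩
    have : (a : ℝ) = a' := by linarith
    exact_mod_cast this
  · exfalso
    have hb' : ((b - b' : ℚ) : ℝ) ≠ 0 := by
      have : (b - b' : ℚ) ≠ 0 := sub_ne_zero.mpr hb
      exact_mod_cast this
    refine hirr ⟨(a' - a) / (b - b'), ?_⟩
    push_cast
    rw [div_eq_iff (by push_cast at hb'; exact hb')]
    linarith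

end BoxIntegral

end Literature.NumberTheory.Transcendental
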